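import Summits.ValiantsHypothesis.ValiantsHypothesis.Theorems.NNDivisionHard.Negative.WeakReliefBlindPermutahedron

/-!
# The weak-relief blindness identity, part 3a (§3 core): Venn-cell machinery and the CORE SET IDENTITY `tilt_core` of the `{0,1}`-tilted permutahedral rows

PORT NOTE (staged by the AUTHOR val-idea-39 g4 for the Negative-lane port hand named by the desk — val-port-3 g3 per #365 (B)/#367; critic of record val-idea-crit-9 g2, V#66 booked §3 as N22's β-kernel leg): texts VERBATIM BY NAME from the crux workfile `Cruxes/NNDivisionHard/WeakReliefBlind39.lean` rev 5 @7c4a19848ae2 (sha16 c2e19d8d627dfa6a, lint-clean); the ONLY changes are the namespace (= parts 1–2, ✓ p679897 / ✓ p680161), the 400-line-cap SPLIT, and one-line docstrings on helper lemmas (gate lint).  VP ≠ VNP is NOT proved; the crux `NNDivisionHard` stays OPEN; `LocatedPencilLaw` is refuted in the kernel by ✓ p679540 (crit-9 α-leg) — these files are an INDEPENDENT certificate at the `{0,1}`-tilt level with λ ≥ 4n+2 (parts 3a/3b) and the small-class theorem for all λ ≥ 1 (part 4).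

§3 (author's docstring, verbatim).  The `{0,1}`-TILTED rows of `Q^Π_λ` are blind too — critic N22 STEP 3 (2026-08-28T23:07:41Z) in the kernel:
`rank₊ S ≤ (n+1)²·(10n² + 4n + 1)` for EVERY `n` and every integer `λ ≥ 4n + 2`, where for rows `(a, c)` (`a` = the clique,
`c` = the support of the rounded tilt `v = 𝟙_a + σ`, so `a∩c` live, `c∖a` ghosts, `a∖c` cancelled) and columns `(b, π)`
`S(a,c;b,π) = (1 − |a∩b|)² + |(a∖c)∩b| + |(c∖a)∖b| + λ·inv(c;π)`,  `inv(c;π) = #{(l ∈ c, l′ ∉ c) : π(l′) < π(l)}`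
(N22's `S` verbatim: off-clique junk `(1−|a∩b|)²`-completion, the two tilt charges, the bubble-sort recourse of STEP 1).
★★★ `tilt_identity` / `tilt_identity'` / `tiltInv_rankPlus_le` (sorry-free).  MECHANISM.  The column announces nothing but reads the
row's announced classes `(k, m) = (|c|, |c∖a|)`; the located set is again the initial segment `P = P_k(π)`; Lemma B (`inv_split`):
`inv(c;π) = |c∖P|·|P∖c| + E` (every pair `(c∖P) × (P∖c)` is an inversion).  With `D = |b∩P| − m − 1` and `κ = [D ≥ 0]` the core set
identity `tilt_core` (generic `P` with `|P| = |c|`) writes `S − λE` as SEVENTEEN nonnegative row×column families (`certG`: 10 pair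
families over `(l,l′)`, 4 single families, 1 constant), e.g. the UDISJ part `(1−|a∩b|)²` is linearised against the live defect
`x_o + y_o` (`x_o = |a∩c∩bᶜ∩Pᶜ|`, `y_o = |a∩c∩b∩Pᶜ|`) when `κ = 1` and paid by `−D ≥ 1` when `κ = 0`; the recourse `λ·d_out·d_in`
(`d_out = |c∖P| = d_in = |P∖c|`) pays `2n·u_P + …` per unit, whence the threshold `λ ≥ 4n + 2` (not optimised; the paper value is
`λ ≳ 2n`).  PROOF TECHNIQUE (reusable): every coordinate sum is expanded into the 16 Venn cells of `(a, c, b, P)` (`sum_expand`), after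
which the identity is ONE `linear_combination` over `ℤ[cells, λ, κ]` with the single relation `|c| = |P|`; exact arithmetic pre-check
`t3/check_merged.py` (all `(a,c,b)`, all `π ∈ S_3`, generic `P` for `n ≤ 4`: 0 mismatches).  CONSEQUENCE for the record: together with
N22 STEP 0–2 (crit-9) this is the P-side certificate that the `{0,1}`-tilt layer of `LocatedPencilLaw`'s enemy `Q^Π_λ` carries no
corruption bound — `xc`-blindness of the tilted located pencil with `(n+1)²(10n²+4n+1)` slots per class-pair, uniformly in `λ ≥ 4n+2`.
VP ≠ VNP is NOT proved; `NNDivisionHard` stays OPEN; this section supports the NEGATIVE edge `LocatedPencilLaw` ↦ refuted-misstated.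
-/

-- the mandated summit-side namespace repeats a component by design (single-problem summit)
set_option linter.dupNamespace false

namespace Summit.ValiantsHypothesis.Theorems.NNDivisionHardNegative.WeakReliefBlind

open Finset
open Summit.ValiantsHypothesis.Theorems.NNDivisionHardNegative.BlindCubeIdentity
  (ind ind_nonneg ind_le_one ind_mul_self ind_inter sum_ind sum_ind_mul sum_ite_eq_sub)

section Tilt
variable {n : ℕ}

/-- `X_l ∈ {0,1}` -/
theorem ind01 (a : Finset (Fin n)) (l : Fin n) : ind a l = 0 ∨ ind a l = 1 := by
  unfold ind; split_ifs <;> simp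

/-- `𝟙_{a∖c} = X(1−C)` -/
theorem ind_sdiff (a c : Finset (Fin n)) (l : Fin n) : ind (a \ c) l = ind a l * (1 - ind c l) := by
  unfold ind; by_cases ha : l ∈ a <;> by_cases hc : l ∈ c <;> simp [ha, hc, Finset.mem_sdiff]

/-- live `a∩c`, ghost `c∖a`, cancelled `a∖c`, light `[n]∖c` indicators of the row `(a,c)` -/
def lv (a c : Finset (Fin n)) (l : Fin n) : ℤ := ind a l * ind c l
/-- ghost indicator `C(1−X)` of `c∖a` -/
def gh (a c : Finset (Fin n)) (l : Fin n) : ℤ := ind c l * (1 - ind a l)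
/-- cancelled indicator `X(1−C)` of `a∖c` -/
def ca (a c : Finset (Fin n)) (l : Fin n) : ℤ := ind a l * (1 - ind c l)
/-- light indicator `1−C` of `[n]∖c` -/
def lt (c : Finset (Fin n)) (l : Fin n) : ℤ := 1 - ind c l
/-- off-diagonal indicator `[l ≠ l′]` -/
def offd (l l' : Fin n) : ℤ := if l = l' then 0 else 1

/-- `lv ≥ 0` -/
theorem lv_nonneg (a c : Finset (Fin n)) (l) : 0 ≤ lv a c l := mul_nonneg (ind_nonneg a l) (ind_nonneg c l)
/-- `gh ≥ 0` -/
theorem gh_nonneg (a c : Finset (Fin n)) (l) : 0 ≤ gh a c l :=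
  mul_nonneg (ind_nonneg c l) (by linarith [ind_le_one a l])
/-- `ca ≥ 0` -/
theorem ca_nonneg (a c : Finset (Fin n)) (l) : 0 ≤ ca a c l :=
  mul_nonneg (ind_nonneg a l) (by linarith [ind_le_one c l])
/-- `lt ≥ 0` -/
theorem lt_nonneg (c : Finset (Fin n)) (l) : 0 ≤ lt c l := by unfold lt; linarith [ind_le_one c l]
/-- `gh ≤ 1` -/
theorem gh_le_one (a c : Finset (Fin n)) (l) : gh a c l ≤ 1 := by
  unfold gh
  have := ind_nonneg a l; have := ind_le_one a l; have := ind_nonneg c l; have := ind_le_one c l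
  nlinarith
/-- `offd ≥ 0` -/
theorem offd_nonneg (l l' : Fin n) : 0 ≤ offd l l' := by unfold offd; split_ifs <;> norm_num

/-! ### Venn-cell expansion: every coordinate sum is a linear form in the 16 cell counts of `(a, c, b, P)` -/

/-- `chi x true = x`, `chi x false = 1 − x`: a membership bit as a factor. (docstring added in the port) -/
def chi (x : ℤ) : Bool → ℤ
  | true => x
  | false => 1 - x
/-- `chi x true = x`. (docstring added in the port) -/
@[simp] theorem chi_true (x : ℤ) : chi x true = x := rfl
/-- `chi x false = 1 − x`. (docstring added in the port) -/
@[simp] theorem chi_false (x : ℤ) : chi x false = 1 - x := rfl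
/-- `Bool ↦ {0,1}` -/
def bi : Bool → ℤ
  | true => 1
  | false => 0
/-- `bi true = 1`. (docstring added in the port) -/
@[simp] theorem bi_true : bi true = 1 := rfl
/-- `bi false = 0`. (docstring added in the port) -/
@[simp] theorem bi_false : bi false = 0 := rfl

/-- a Venn cell of `(a, c, b, P)`: four membership bits -/
abbrev Cell := Bool × Bool × Bool × Bool

/-- indicator that coordinate `l` lies in the Venn cell `e` of `(a, c, b, P)` -/
def cellInd (a c b P : Finset (Fin n)) (l : Fin n) (e : Cell) : ℤ :=
  chi (ind a l) e.1 * chi (ind c l) e.2.1 * chi (ind b l) e.2.2.1 * chi (ind P l) e.2.2.2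

/-- the 16 Venn-cell counts of `(a, c, b, P)` -/
def cellN (a c b P : Finset (Fin n)) (e : Cell) : ℤ := ∑ l, cellInd a c b P l e

/-- a polynomial in the four indicators at `l` equals its cell expansion -/
theorem expand (p : ℤ → ℤ → ℤ → ℤ → ℤ) (a c b P : Finset (Fin n)) (l : Fin n) :
    p (ind a l) (ind c l) (ind b l) (ind P l) =
      ∑ e : Cell, p (bi e.1) (bi e.2.1) (bi e.2.2.1) (bi e.2.2.2) * cellInd a c b P l e := by
  simp only [Fintype.sum_prod_type, Fintype.sum_bool, cellInd, bi_true, bi_false, chi_true, chi_false]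
  rcases ind01 a l with h1 | h1 <;> rcases ind01 c l with h2 | h2 <;> rcases ind01 b l with h3 | h3 <;>
    rcases ind01 P l with h4 | h4 <;> simp only [h1, h2, h3, h4] <;> norm_num

/-- a coordinate sum of a polynomial in the four indicators equals the weighted sum of the 16 cell counts -/
theorem sum_expand (p : ℤ → ℤ → ℤ → ℤ → ℤ) (a c b P : Finset (Fin n)) :
    ∑ l, p (ind a l) (ind c l) (ind b l) (ind P l) =
      ∑ e : Cell, p (bi e.1) (bi e.2.1) (bi e.2.2.1) (bi e.2.2.2) * cellN a c b P e := by
  simp_rw [expand p a c b P]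
  rw [Finset.sum_comm]
  refine Finset.sum_congr rfl fun e _ => ?_
  rw [cellN, Finset.mul_sum]

/-! ### separation helpers for the pair families -/

/-- A double sum of a `κ`-scaled product separates. (docstring added in the port) -/
theorem sum2_sep (κ : ℤ) (f g : Fin n → ℤ) (h : Fin n → Fin n → ℤ) (hh : ∀ l l', h l l' = κ * (f l * g l')) :
    ∑ l, ∑ l', h l l' = κ * ((∑ l, f l) * (∑ l, g l)) := by
  rw [Finset.sum_mul_sum, Finset.mul_sum]
  refine Finset.sum_congr rfl fun l _ => ?_
  rw [Finset.mul_sum]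
  exact Finset.sum_congr rfl fun l' _ => hh l l'

/-- an off-diagonal separated double sum: `Σ_{l≠l′} κ f(l) g(l′) = κ(Σf·Σg − Σ fg)` -/
theorem sum2_offd (κ : ℤ) (f g : Fin n → ℤ) (h : Fin n → Fin n → ℤ)
    (hh : ∀ l l', h l l' = κ * (offd l l' * (f l * g l'))) :
    ∑ l, ∑ l', h l l' = κ * ((∑ l, f l) * (∑ l, g l) - ∑ l, f l * g l) := by
  have e1 : ∀ l l', h l l' = κ * (f l * g l') - (if l = l' then κ * (f l * g l') else 0) := by
    intro l l'; rw [hh]; unfold offd; split_ifs <;> ring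
  have e2 : ∀ l, ∑ l', h l l' = κ * (f l * ∑ l', g l') - κ * (f l * g l) := by
    intro l
    rw [Finset.sum_congr rfl (fun l' _ => e1 l l'), Finset.sum_sub_distrib, Finset.sum_ite_eq]
    simp only [Finset.mem_univ, if_true]
    rw [Finset.mul_sum, Finset.mul_sum]
  rw [Finset.sum_congr rfl (fun l _ => e2 l), Finset.sum_sub_distrib, ← Finset.mul_sum, ← Finset.mul_sum,
    Finset.sum_mul]
  ring

/-- a double sum of a two-term summand splits -/
theorem sum2_add2 (h h₁ h₂ : Fin n → Fin n → ℤ) (hh : ∀ l l', h l l' = h₁ l l' + h₂ l l') :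
    ∑ l, ∑ l', h l l' = (∑ l, ∑ l', h₁ l l') + ∑ l, ∑ l', h₂ l l' := by
  rw [← Finset.sum_add_distrib]
  refine Finset.sum_congr rfl fun l _ => ?_
  rw [← Finset.sum_add_distrib]
  exact Finset.sum_congr rfl fun l' _ => hh l l'

/-- a double sum of a three-term summand splits -/
theorem sum2_add3 (h h₁ h₂ h₃ : Fin n → Fin n → ℤ) (hh : ∀ l l', h l l' = h₁ l l' + h₂ l l' + h₃ l l') :
    ∑ l, ∑ l', h l l' = (∑ l, ∑ l', h₁ l l') + (∑ l, ∑ l', h₂ l l') + ∑ l, ∑ l', h₃ l l' := by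
  rw [← Finset.sum_add_distrib, ← Finset.sum_add_distrib]
  refine Finset.sum_congr rfl fun l _ => ?_
  rw [← Finset.sum_add_distrib, ← Finset.sum_add_distrib]
  exact Finset.sum_congr rfl fun l' _ => hh l l'

/-! ### the certificate -/

/-- index of the tilted certificate inside one class: a constant slot, 4 single families, 10 pair families -/
abbrev TIdx (n : ℕ) := Unit ⊕ (Fin 4 × Fin n) ⊕ (Fin 10 × (Fin n × Fin n))

/-- row factors of the pair families (pure products of type indicators) -/
def pairRow (a c : Finset (Fin n)) : Fin 10 → Fin n → Fin n → ℤ :=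
  ![fun l l' => ca a c l * ca a c l', fun l l' => ca a c l * lv a c l', fun l l' => ind c l * lt c l',
    fun l l' => lv a c l * lv a c l', fun l l' => gh a c l * gh a c l', fun l l' => gh a c l * lv a c l',
    fun l l' => lt c l * lt c l', fun l l' => lt c l * lv a c l', fun l l' => lt c l * (1 - gh a c l'),
    fun l l' => lt c l * gh a c l']

/-- row factors of the single families -/
def singRow (a c : Finset (Fin n)) : Fin 4 → Fin n → ℤ :=
  ![fun l => lt c l, fun l => ind c l, fun l => gh a c l, fun l => lv a c l]

/-- column factors of the pair families (generic in `P, κ, D`; the inversion indicator enters family 2 only) -/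
def pairColG (lam κ : ℤ) (b P : Finset (Fin n)) (I : Fin n → Fin n → ℤ) : Fin 10 → Fin n → Fin n → ℤ :=
  ![fun l l' => offd l l' * (ind b l * ind b l'),
    fun l l' => 2 * (ind b l * ind b l'),
    fun l l' => lam * (((1 - ind P l) * (1 - ind P l') + ind P l * ind P l') * I l l' +
      κ * ((1 - ind P l) * ((1 - ind b l') * ind P l'))),
    fun l l' => offd l l' * ((1 - κ) * (ind b l * ind b l')) +
      κ * ((ind b l * (1 - ind P l)) * (ind b l' * (1 - ind P l'))),
    fun l l' => κ * (((1 - ind b l) * ind P l) * ((1 - ind b l') * ind P l') + (1 - ind P l) * (1 - ind P l') +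
      2 * (((1 - ind b l) * ind P l) * (1 - ind P l'))),
    fun l l' => κ * (2 * (((1 - ind b l) * ind P l) * (ind b l' * (1 - ind P l'))) +
      2 * ((1 - ind P l) * (ind b l' * (1 - ind P l')))),
    fun l l' => offd l l' * ((1 - κ) * (lam * (ind P l * ind P l')) +
      κ * ((lam - 2) * ((ind b l * ind P l) * (ind b l' * ind P l')))) +
      κ * ((ind b l * ind P l) * ((ind b l' * ind P l') + (lam - 2) * ((1 - ind b l') * ind P l'))),
    fun l l' => κ * (2 * ((ind b l * ind P l) * ((1 - ind b l') * (1 - ind P l')))),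
    fun l _ => κ * (2 * (ind b l * ind P l)),
    fun l l' => κ * (2 * ((ind b l * ind P l) * (ind b l' + (1 - ind b l') * (1 - ind P l'))))]

/-- column factors of the single families (generic) -/
def singColG (lam κ D : ℤ) (nn : ℤ) (b P : Finset (Fin n)) : Fin 4 → Fin n → ℤ :=
  ![fun l => (1 - κ) * (ind b l * ind P l) + κ * ((lam - 2 - 2 * nn - 2 * D) * (ind b l * ind P l)),
    fun l => (1 - κ) * ((1 - ind P l) * (lam - ind b l)),
    fun l => κ * (2 * D * ((1 - ind b l) * ind P l) + 2 * D * (1 - ind P l) + (1 - ind b l) * ind P l +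
      (1 - ind b l) * (1 - ind P l)),
    fun l => κ * (2 * D * (ind b l * (1 - ind P l)))]

/-- the constant slot (generic) -/
def constColG (κ D : ℤ) : ℤ := (1 - κ) * (-D) + κ * D ^ 2

/-- the generic certificate value `Σ_s row_s · col_s` written out -/
def certG (lam κ D nn : ℤ) (a c b P : Finset (Fin n)) (I : Fin n → Fin n → ℤ) : ℤ :=
  constColG κ D + (∑ j : Fin 4, ∑ l, singRow a c j l * singColG lam κ D nn b P j l) +
    ∑ j : Fin 10, ∑ l, ∑ l', pairRow a c j l l' * pairColG lam κ b P I j l l'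

/-- ★ THE CORE SET IDENTITY (generic located set `P` with `|P| = |c|`, `κ ∈ {0,1}`, `D = |b∩P| − |c∖a| − 1`):
`(1−|a∩b|)² + |(a∖c)∩b| + |(c∖a)∖b| + λ·(|c∖P|·|P∖c| + E) = certG`, where `E` is the generic pair sum of family 2. -/
theorem tilt_core (lam κ D : ℤ) (a c b P : Finset (Fin n)) (I : Fin n → Fin n → ℤ) (hP : P.card = c.card)
    (hD : D = ((b ∩ P).card : ℤ) - ((c \ a).card : ℤ) - 1) (hκ : κ = 0 ∨ κ = 1) :
    (1 - ((a ∩ b).card : ℤ)) ^ 2 + (((a \ c) ∩ b).card : ℤ) + (((c \ a) \ b).card : ℤ) +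
      lam * ((∑ l, ind c l * (1 - ind P l)) * (∑ l, lt c l * ind P l) +
        ∑ l, ∑ l', ind c l * lt c l' * ((((1 - ind P l) * (1 - ind P l') + ind P l * ind P l') * I l l'))) =
      certG lam κ D (n : ℤ) a c b P I := by
  unfold certG
  simp only [Fin.sum_univ_succ, Fin.sum_univ_zero, pairRow, singRow, pairColG, singColG, constColG,
    Matrix.cons_val_zero, Matrix.cons_val_succ, add_zero]
  -- (1) cards to coordinate sums
  have c1 : ((a ∩ b).card : ℤ) = ∑ l, ind a l * ind b l := (sum_ind_mul a b).symm
  have c2 : (((a \ c) ∩ b).card : ℤ) = ∑ l, ca a c l * ind b l := by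
    rw [← sum_ind_mul]; exact Finset.sum_congr rfl fun l _ => by rw [ind_sdiff]; rfl
  have c3 : (((c \ a) \ b).card : ℤ) = ∑ l, gh a c l * (1 - ind b l) := by
    rw [← sum_ind]; exact Finset.sum_congr rfl fun l _ => by rw [ind_sdiff, ind_sdiff]; rfl
  have c4 : ((b ∩ P).card : ℤ) = ∑ l, ind b l * ind P l := (sum_ind_mul b P).symm
  have c5 : ((c \ a).card : ℤ) = ∑ l, gh a c l := by
    rw [← sum_ind]; exact Finset.sum_congr rfl fun l _ => by rw [ind_sdiff]; rfl
  have hR2 : ∑ l, ind c l = ∑ l, ind P l := by rw [sum_ind, sum_ind, hP]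
  have hn : ((n : ℕ) : ℤ) = ∑ l : Fin n, (1 : ℤ) := by simp
  rw [c1, c2, c3]
  rw [c4, c5] at hD
  -- (2) separate the pair families
  have hP0 : (∑ l, ∑ l', ca a c l * ca a c l' * (offd l l' * (ind b l * ind b l'))) =
      1 * ((∑ l, ca a c l * ind b l) * (∑ l, ca a c l * ind b l) - ∑ l, ca a c l * ind b l * (ca a c l * ind b l)) :=
    sum2_offd 1 (fun l => ca a c l * ind b l) (fun l => ca a c l * ind b l) _ (fun l l' => by ring)
  have hP1 : (∑ l, ∑ l', ca a c l * lv a c l' * (2 * (ind b l * ind b l'))) =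
      2 * ((∑ l, ca a c l * ind b l) * (∑ l, lv a c l * ind b l)) :=
    sum2_sep 2 (fun l => ca a c l * ind b l) (fun l => lv a c l * ind b l) _ (fun l l' => by ring)
  have hP2 : (∑ l, ∑ l', ind c l * lt c l' * (lam * (((1 - ind P l) * (1 - ind P l') + ind P l * ind P l') * I l l' +
      κ * ((1 - ind P l) * ((1 - ind b l') * ind P l'))))) =
      (∑ l, ∑ l', lam * (ind c l * lt c l' * ((((1 - ind P l) * (1 - ind P l') + ind P l * ind P l') * I l l')))) +
      ∑ l, ∑ l', (lam * κ) * ((ind c l * (1 - ind P l)) * (lt c l' * ((1 - ind b l') * ind P l'))) :=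
    sum2_add2 _ _ _ (fun l l' => by ring)
  have hP2a : (∑ l, ∑ l', lam * (ind c l * lt c l' * ((((1 - ind P l) * (1 - ind P l') + ind P l * ind P l') * I l l')))) =
      lam * ∑ l, ∑ l', ind c l * lt c l' * ((((1 - ind P l) * (1 - ind P l') + ind P l * ind P l') * I l l')) := by
    rw [Finset.mul_sum]; exact Finset.sum_congr rfl fun l _ => by rw [Finset.mul_sum]
  have hP2b : (∑ l, ∑ l', (lam * κ) * ((ind c l * (1 - ind P l)) * (lt c l' * ((1 - ind b l') * ind P l')))) =
      (lam * κ) * ((∑ l, ind c l * (1 - ind P l)) * (∑ l, lt c l * ((1 - ind b l) * ind P l))) :=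
    sum2_sep (lam * κ) (fun l => ind c l * (1 - ind P l)) (fun l => lt c l * ((1 - ind b l) * ind P l)) _ (fun l l' => by ring)
  have hP3 : (∑ l, ∑ l', lv a c l * lv a c l' * (offd l l' * ((1 - κ) * (ind b l * ind b l')) +
      κ * ((ind b l * (1 - ind P l)) * (ind b l' * (1 - ind P l'))))) =
      (∑ l, ∑ l', (1 - κ) * (offd l l' * ((lv a c l * ind b l) * (lv a c l' * ind b l')))) +
      ∑ l, ∑ l', κ * ((lv a c l * (ind b l * (1 - ind P l))) * (lv a c l' * (ind b l' * (1 - ind P l')))) :=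
    sum2_add2 _ _ _ (fun l l' => by ring)
  have hP3a : (∑ l, ∑ l', (1 - κ) * (offd l l' * ((lv a c l * ind b l) * (lv a c l' * ind b l')))) =
      (1 - κ) * ((∑ l, lv a c l * ind b l) * (∑ l, lv a c l * ind b l) - ∑ l, lv a c l * ind b l * (lv a c l * ind b l)) :=
    sum2_offd (1 - κ) (fun l => lv a c l * ind b l) (fun l => lv a c l * ind b l) _ (fun l l' => by ring)
  have hP3b : (∑ l, ∑ l', κ * ((lv a c l * (ind b l * (1 - ind P l))) * (lv a c l' * (ind b l' * (1 - ind P l'))))) =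
      κ * ((∑ l, lv a c l * (ind b l * (1 - ind P l))) * (∑ l, lv a c l * (ind b l * (1 - ind P l)))) :=
    sum2_sep κ (fun l => lv a c l * (ind b l * (1 - ind P l))) (fun l => lv a c l * (ind b l * (1 - ind P l))) _
      (fun l l' => by ring)
  have hP4 : (∑ l, ∑ l', gh a c l * gh a c l' * (κ * ((1 - ind b l) * ind P l * ((1 - ind b l') * ind P l') +
      (1 - ind P l) * (1 - ind P l') + 2 * ((1 - ind b l) * ind P l * (1 - ind P l'))))) =
      (∑ l, ∑ l', κ * ((gh a c l * ((1 - ind b l) * ind P l)) * (gh a c l' * ((1 - ind b l') * ind P l')))) +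
      (∑ l, ∑ l', κ * ((gh a c l * (1 - ind P l)) * (gh a c l' * (1 - ind P l')))) +
      ∑ l, ∑ l', (2 * κ) * ((gh a c l * ((1 - ind b l) * ind P l)) * (gh a c l' * (1 - ind P l'))) :=
    sum2_add3 _ _ _ _ (fun l l' => by ring)
  have hP4a : (∑ l, ∑ l', κ * ((gh a c l * ((1 - ind b l) * ind P l)) * (gh a c l' * ((1 - ind b l') * ind P l')))) =
      κ * ((∑ l, gh a c l * ((1 - ind b l) * ind P l)) * (∑ l, gh a c l * ((1 - ind b l) * ind P l))) :=
    sum2_sep κ _ _ _ (fun l l' => by ring)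
  have hP4b : (∑ l, ∑ l', κ * ((gh a c l * (1 - ind P l)) * (gh a c l' * (1 - ind P l')))) =
      κ * ((∑ l, gh a c l * (1 - ind P l)) * (∑ l, gh a c l * (1 - ind P l))) :=
    sum2_sep κ _ _ _ (fun l l' => by ring)
  have hP4c : (∑ l, ∑ l', (2 * κ) * ((gh a c l * ((1 - ind b l) * ind P l)) * (gh a c l' * (1 - ind P l')))) =
      (2 * κ) * ((∑ l, gh a c l * ((1 - ind b l) * ind P l)) * (∑ l, gh a c l * (1 - ind P l))) :=
    sum2_sep (2 * κ) _ _ _ (fun l l' => by ring)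
  have hP5 : (∑ l, ∑ l', gh a c l * lv a c l' * (κ * (2 * ((1 - ind b l) * ind P l * (ind b l' * (1 - ind P l'))) +
      2 * ((1 - ind P l) * (ind b l' * (1 - ind P l')))))) =
      (∑ l, ∑ l', (2 * κ) * ((gh a c l * ((1 - ind b l) * ind P l)) * (lv a c l' * (ind b l' * (1 - ind P l'))))) +
      ∑ l, ∑ l', (2 * κ) * ((gh a c l * (1 - ind P l)) * (lv a c l' * (ind b l' * (1 - ind P l')))) :=
    sum2_add2 _ _ _ (fun l l' => by ring)
  have hP5a : (∑ l, ∑ l', (2 * κ) * ((gh a c l * ((1 - ind b l) * ind P l)) * (lv a c l' * (ind b l' * (1 - ind P l'))))) =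
      (2 * κ) * ((∑ l, gh a c l * ((1 - ind b l) * ind P l)) * (∑ l, lv a c l * (ind b l * (1 - ind P l)))) :=
    sum2_sep (2 * κ) _ _ _ (fun l l' => by ring)
  have hP5b : (∑ l, ∑ l', (2 * κ) * ((gh a c l * (1 - ind P l)) * (lv a c l' * (ind b l' * (1 - ind P l'))))) =
      (2 * κ) * ((∑ l, gh a c l * (1 - ind P l)) * (∑ l, lv a c l * (ind b l * (1 - ind P l)))) :=
    sum2_sep (2 * κ) _ _ _ (fun l l' => by ring)
  have hP6 : (∑ l, ∑ l', lt c l * lt c l' * (offd l l' * ((1 - κ) * (lam * (ind P l * ind P l')) +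
      κ * ((lam - 2) * (ind b l * ind P l * (ind b l' * ind P l')))) +
      κ * (ind b l * ind P l * (ind b l' * ind P l' + (lam - 2) * ((1 - ind b l') * ind P l'))))) =
      (∑ l, ∑ l', ((1 - κ) * lam) * (offd l l' * ((lt c l * ind P l) * (lt c l' * ind P l')))) +
      (∑ l, ∑ l', (κ * (lam - 2)) * (offd l l' * ((lt c l * (ind b l * ind P l)) * (lt c l' * (ind b l' * ind P l'))))) +
      ∑ l, ∑ l', κ * ((lt c l * (ind b l * ind P l)) *
        (lt c l' * (ind b l' * ind P l' + (lam - 2) * ((1 - ind b l') * ind P l')))) :=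
    sum2_add3 _ _ _ _ (fun l l' => by ring)
  have hP6a : (∑ l, ∑ l', ((1 - κ) * lam) * (offd l l' * ((lt c l * ind P l) * (lt c l' * ind P l')))) =
      ((1 - κ) * lam) * ((∑ l, lt c l * ind P l) * (∑ l, lt c l * ind P l) - ∑ l, lt c l * ind P l * (lt c l * ind P l)) :=
    sum2_offd ((1 - κ) * lam) _ _ _ (fun l l' => by ring)
  have hP6b : (∑ l, ∑ l', (κ * (lam - 2)) * (offd l l' * ((lt c l * (ind b l * ind P l)) * (lt c l' * (ind b l' * ind P l'))))) =
      (κ * (lam - 2)) * ((∑ l, lt c l * (ind b l * ind P l)) * (∑ l, lt c l * (ind b l * ind P l)) -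
        ∑ l, lt c l * (ind b l * ind P l) * (lt c l * (ind b l * ind P l))) :=
    sum2_offd (κ * (lam - 2)) _ _ _ (fun l l' => by ring)
  have hP6c : (∑ l, ∑ l', κ * ((lt c l * (ind b l * ind P l)) *
        (lt c l' * (ind b l' * ind P l' + (lam - 2) * ((1 - ind b l') * ind P l'))))) =
      κ * ((∑ l, lt c l * (ind b l * ind P l)) * (∑ l, lt c l * (ind b l * ind P l + (lam - 2) * ((1 - ind b l) * ind P l)))) :=
    sum2_sep κ _ _ _ (fun l l' => by ring)
  have hP7 : (∑ l, ∑ l', lt c l * lv a c l' * (κ * (2 * (ind b l * ind P l * ((1 - ind b l') * (1 - ind P l')))))) =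
      (2 * κ) * ((∑ l, lt c l * (ind b l * ind P l)) * (∑ l, lv a c l * ((1 - ind b l) * (1 - ind P l)))) :=
    sum2_sep (2 * κ) _ _ _ (fun l l' => by ring)
  have hP8 : (∑ l, ∑ l', lt c l * (1 - gh a c l') * (κ * (2 * (ind b l * ind P l)))) =
      (2 * κ) * ((∑ l, lt c l * (ind b l * ind P l)) * (∑ l, (1 - gh a c l))) :=
    sum2_sep (2 * κ) _ _ _ (fun l l' => by ring)
  have hP9 : (∑ l, ∑ l', lt c l * gh a c l' * (κ * (2 * (ind b l * ind P l * (ind b l' + (1 - ind b l') * (1 - ind P l')))))) =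
      (2 * κ) * ((∑ l, lt c l * (ind b l * ind P l)) * (∑ l, gh a c l * (ind b l + (1 - ind b l) * (1 - ind P l)))) :=
    sum2_sep (2 * κ) _ _ _ (fun l l' => by ring)
  rw [hP0, hP1, hP2, hP2a, hP2b, hP3, hP3a, hP3b, hP4, hP4a, hP4b, hP4c, hP5, hP5a, hP5b, hP6, hP6a, hP6b, hP6c,
    hP7, hP8, hP9]
  -- (3) Venn-cell expansion of every coordinate sum
  have x1 : (∑ l, ca a c l * ind b l) = _ := sum_expand (fun A C B Q => A * (1 - C) * B) a c b P
  have x2 : (∑ l, ca a c l * ind b l * (ca a c l * ind b l)) = _ :=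
    sum_expand (fun A C B Q => A * (1 - C) * B * (A * (1 - C) * B)) a c b P
  have x3 : (∑ l, lv a c l * ind b l) = _ := sum_expand (fun A C B Q => A * C * B) a c b P
  have x4 : (∑ l, lv a c l * ind b l * (lv a c l * ind b l)) = _ :=
    sum_expand (fun A C B Q => A * C * B * (A * C * B)) a c b P
  have x5 : (∑ l, ind c l * (1 - ind P l)) = _ := sum_expand (fun A C B Q => C * (1 - Q)) a c b P
  have x6 : (∑ l, lt c l * ((1 - ind b l) * ind P l)) = _ := sum_expand (fun A C B Q => (1 - C) * ((1 - B) * Q)) a c b P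
  have x7 : (∑ l, lv a c l * (ind b l * (1 - ind P l))) = _ :=
    sum_expand (fun A C B Q => A * C * (B * (1 - Q))) a c b P
  have x8 : (∑ l, gh a c l * ((1 - ind b l) * ind P l)) = _ :=
    sum_expand (fun A C B Q => C * (1 - A) * ((1 - B) * Q)) a c b P
  have x9 : (∑ l, gh a c l * (1 - ind P l)) = _ := sum_expand (fun A C B Q => C * (1 - A) * (1 - Q)) a c b P
  have x10 : (∑ l, lt c l * ind P l) = _ := sum_expand (fun A C B Q => (1 - C) * Q) a c b P
  have x11 : (∑ l, lt c l * ind P l * (lt c l * ind P l)) = _ :=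
    sum_expand (fun A C B Q => (1 - C) * Q * ((1 - C) * Q)) a c b P
  have x12 : (∑ l, lt c l * (ind b l * ind P l)) = _ := sum_expand (fun A C B Q => (1 - C) * (B * Q)) a c b P
  have x13 : (∑ l, lt c l * (ind b l * ind P l) * (lt c l * (ind b l * ind P l))) = _ :=
    sum_expand (fun A C B Q => (1 - C) * (B * Q) * ((1 - C) * (B * Q))) a c b P
  have x14 : (∑ l, lt c l * (ind b l * ind P l + (lam - 2) * ((1 - ind b l) * ind P l))) = _ :=
    sum_expand (fun A C B Q => (1 - C) * (B * Q + (lam - 2) * ((1 - B) * Q))) a c b P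
  have x15 : (∑ l, lv a c l * ((1 - ind b l) * (1 - ind P l))) = _ :=
    sum_expand (fun A C B Q => A * C * ((1 - B) * (1 - Q))) a c b P
  have x16 : (∑ l, (1 - gh a c l)) = _ := sum_expand (fun A C B Q => 1 - C * (1 - A)) a c b P
  have x17 : (∑ l, gh a c l * (ind b l + (1 - ind b l) * (1 - ind P l))) = _ :=
    sum_expand (fun A C B Q => C * (1 - A) * (B + (1 - B) * (1 - Q))) a c b P
  have x18 : (∑ l, lt c l * ((1 - κ) * (ind b l * ind P l) + κ * ((lam - 2 - 2 * (n : ℤ) - 2 * D) * (ind b l * ind P l)))) = _ :=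
    sum_expand (fun A C B Q => (1 - C) * ((1 - κ) * (B * Q) + κ * ((lam - 2 - 2 * (n : ℤ) - 2 * D) * (B * Q)))) a c b P
  have x19 : (∑ l, ind c l * ((1 - κ) * ((1 - ind P l) * (lam - ind b l)))) = _ :=
    sum_expand (fun A C B Q => C * ((1 - κ) * ((1 - Q) * (lam - B)))) a c b P
  have x20 : (∑ l, gh a c l * (κ * (2 * D * ((1 - ind b l) * ind P l) + 2 * D * (1 - ind P l) + (1 - ind b l) * ind P l +
      (1 - ind b l) * (1 - ind P l)))) = _ :=
    sum_expand (fun A C B Q => C * (1 - A) * (κ * (2 * D * ((1 - B) * Q) + 2 * D * (1 - Q) + (1 - B) * Q +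
      (1 - B) * (1 - Q)))) a c b P
  have x21 : (∑ l, lv a c l * (κ * (2 * D * (ind b l * (1 - ind P l))))) = _ :=
    sum_expand (fun A C B Q => A * C * (κ * (2 * D * (B * (1 - Q))))) a c b P
  have x22 : (∑ l, ind a l * ind b l) = _ := sum_expand (fun A C B Q => A * B) a c b P
  have x23 : (∑ l, gh a c l * (1 - ind b l)) = _ := sum_expand (fun A C B Q => C * (1 - A) * (1 - B)) a c b P
  have x24 : (∑ l, ind b l * ind P l) = _ := sum_expand (fun A C B Q => B * Q) a c b P
  have x25 : (∑ l, gh a c l) = _ := sum_expand (fun A C B Q => C * (1 - A)) a c b P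
  have x26 : (∑ l, ind c l) = _ := sum_expand (fun A C B Q => C) a c b P
  have x27 : (∑ l, ind P l) = _ := sum_expand (fun A C B Q => Q) a c b P
  have x28 : (∑ l : Fin n, (1 : ℤ)) = _ := sum_expand (fun A C B Q => 1) a c b P
  rw [x1, x2, x3, x4, x5, x6, x7, x8, x9, x10, x11, x12, x13, x14, x15, x16, x17, x18, x19, x20, x21, x22, x23]
  rw [x24, x25] at hD
  rw [x26, x27] at hR2
  rw [x28] at hn
  rw [hn]
  simp only [Fintype.sum_prod_type, Fintype.sum_bool, bi_true, bi_false] at hD hR2 ⊢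
  subst hD
  rcases hκ with rfl | rfl
  · linear_combination (lam * (cellN a c b P (true, false, true, true) + cellN a c b P (true, false, false, true) +
      cellN a c b P (false, false, true, true) + cellN a c b P (false, false, false, true) - 1)) * hR2
  · linear_combination ((lam - 2) * (cellN a c b P (true, false, true, true) + cellN a c b P (false, false, true, true))) * hR2


end Tilt

end Summit.ValiantsHypothesis.Theorems.NNDivisionHardNegative.WeakReliefBlind
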